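import Mathlib
import Literature.Analysis.FluidPDE.VectorCalculus
import Literature.Analysis.FluidPDE.VorticityStretching
import Summits.NavierStokesRegularity.NavierStokesRegularity.Theorems.ThreadingFluxCentreJetDefs
import Summits.NavierStokesRegularity.NavierStokesRegularity.Theorems.ThreadingFluxPlatonicDefs
import Summits.NavierStokesRegularity.NavierStokesRegularity.Theorems.ThreadingFluxPlatonicSymmetryAlgebra
import Summits.NavierStokesRegularity.NavierStokesRegularity.Theorems.ThreadingFluxPlatonicCentreJetAlgebra
import HarnessLib

/-!
# Crux `PoloidalLiouville` (stmt-NavierStokesRegularity-1222, wall W1), crux idea «platonic-germ-sieve» (ns-idea-15 g11, V27):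
# (J4-alg) THE CUBIC O-EQUIVARIANTS — symmetric trilinear maps of `ℝ³` commuting with the rotations of the cube

Support file (Theorems-side; seat ns-wall-eng-7 g11, cell `ns-wall-extremal`, W1 adjunct; critic ns-wall-crit-1 g8 BATCH #27 SIZE S–M /
NO STRIKE; `--supports stmt-NavierStokesRegularity-1222 --as helper`; 0 kit).  Pure linear algebra, the degree-three sequel of
ns-wall-eng-7 g9's `CentreFlat.clm_eq_smul_id` (degree one: Schur) and `CentreFlat.bilin_eq_zero` (degree two: nothing) in
`ThreadingFluxPlatonicCentreJetAlgebra.lean` (p724514), whose coordinate lemmas for the five generators (the half-turns `diag(s)`, the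
coordinate 3-cycle `c`, the quarter-turn `q` about `e₂`) are imported BY NAME:

* `CentreFlat.parity_three` — parities of a trilinear map commuting with a coordinate half-turn;
* `CentreFlat.trilin_apply_single` — the 81 matrix entries `T(eⱼ, e_k, e_l)ᵢ` of a SYMMETRIC trilinear `T : ℝ³ × ℝ³ × ℝ³ → ℝ³` commuting
  with the half-turns about `e₀`, `e₁`, the 3-cycle and the quarter-turn: the half-turn parities leave only the index patterns `(iiii)` and
  `(iijj)`, the 3-cycle and `q` (with the symmetry) equalise them to TWO constants `A = T(e₀,e₀,e₀)₀`, `B = T(e₀,e₀,e₁)₁`;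
* ★ `CentreFlat.trilin_eq` — the normal form: `T u v w = B • (⟪u,v⟫ w + ⟪v,w⟫ u + ⟪w,u⟫ v) + (A − 3B) • (uᵢ vᵢ wᵢ)ᵢ`.  Equivalently: the
  O-equivariant homogeneous CUBIC maps `ℝ³ → ℝ³` are exactly `span{‖x‖² x, (xᵢ³)ᵢ} = span{∇‖x‖⁴, ∇Σᵢxᵢ⁴}` — a plane, all of it gradients
  (Solomon's degree-3 slot of the equivariants of the reflection group `O_h = B₃`; a cubic map is odd, so O- and O_h-equivariance agree);
* `CentreFlat.trilin_trace` — the trace `Σᵢ T(u, v, eᵢ)ᵢ = (A + 2B) ⟪u, v⟫` (the divergence of the cubic map is `3(A + 2B)‖x‖²`);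
* `CentreFlat.trilin_inner_self` — the tangency form `⟪u, T(u,u,u)⟫ = (A − 3B) Σᵢuᵢ⁴ + 3B ‖u‖⁴`, and
  ★ `CentreFlat.trilin_eq_zero_of_inner_self` — if `⟪u, T(u,u,u)⟫ = 0` for all `u` then `T = 0` (`Σuᵢ⁴` and `‖u‖⁴` are independent:
  test `u = e₀` and `u = e₀ + e₁`).

Consumed by `Theorems/ThreadingFluxPlatonicCentreJetCubic.lean` ((J4): the cubic jet `D³V(0)` of an O-equivariant germ; (J4′): the vorticity
of an O-equivariant UNTHREADED germ is 3-flat at the centre).  HONEST LABEL: representation-theoretic tools strictly below W1, no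
Navier–Stokes input; no statement of the card is asserted; `OctahedralCentreRigidity`, `PoloidalLiouville` (1222), `UnthreadedRigidity`
(27585) and NS regularity are OPEN — NOT proved.  [folklore; L. Solomon, Invariants of finite reflection groups, Nagoya Math. J. 22 (1963)
57–64, for the invariant theory behind it]
-/

-- the summit and its single sub-problem share the name (CONVENTIONS §1)
set_option linter.dupNamespace false

noncomputable section

open Set Function Filter Metric
open scoped RealInnerProductSpace Topology
open Literature.Analysis.FluidPDE
open Summit.NavierStokesRegularity.NavierStokesRegularity.Theorems.PoloidalLiouville.CentreJet (E3)

namespace Summit.NavierStokesRegularity.NavierStokesRegularity.Theorems.PoloidalLiouville.Platonic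

namespace CentreFlat

section Trilinear

variable {T : E3 →L[ℝ] E3 →L[ℝ] E3 →L[ℝ] E3}

/-- Parities of a trilinear map commuting with a coordinate half-turn `diag(s)`: `sⱼ s_k s_l · T(eⱼ,e_k,e_l)ᵢ = sᵢ · T(eⱼ,e_k,e_l)ᵢ`. -/
theorem parity_three {s : Fin 3 → ℝ}
    (hs : ∀ u v w, T (cubeRot 1 s u) (cubeRot 1 s v) (cubeRot 1 s w) = cubeRot 1 s (T u v w)) (j k l i : Fin 3) :
    s j * s k * s l * T (EuclideanSpace.single j (1 : ℝ)) (EuclideanSpace.single k (1 : ℝ)) (EuclideanSpace.single l (1 : ℝ)) i =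
      s i * T (EuclideanSpace.single j (1 : ℝ)) (EuclideanSpace.single k (1 : ℝ)) (EuclideanSpace.single l (1 : ℝ)) i := by
  have h := congrArg (fun w : E3 => w i)
    (hs (EuclideanSpace.single j 1) (EuclideanSpace.single k 1) (EuclideanSpace.single l 1))
  simp only [cubeRot_one_single, map_smul, FunLike.coe_smul, Pi.smul_apply, PiLp.smul_apply,
    smul_eq_mul, cubeRot_one_apply] at h
  linear_combination h

/-- **The 81 entries of a symmetric trilinear O-equivariant.**  For a SYMMETRIC trilinear `T : ℝ³ × ℝ³ × ℝ³ → ℝ³` commuting with the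
half-turns about `e₀`, `e₁`, the coordinate 3-cycle and the quarter-turn about `e₂`:
`T(eⱼ,e_k,e_l)ᵢ = B (δⱼₖ δᵢₗ + δₖₗ δᵢⱼ + δₗⱼ δᵢₖ) + (A − 3B) δᵢⱼ δᵢₖ δᵢₗ` with `A = T(e₀,e₀,e₀)₀`, `B = T(e₀,e₀,e₁)₁`. -/
theorem trilin_apply_single (hsym : ∀ u v w, T u v w = T v u w) (hsym' : ∀ u v w, T u v w = T u w v)
    (h0 : ∀ u v w, T (cubeRot 1 ![1, -1, -1] u) (cubeRot 1 ![1, -1, -1] v) (cubeRot 1 ![1, -1, -1] w) =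
      cubeRot 1 ![1, -1, -1] (T u v w))
    (h1 : ∀ u v w, T (cubeRot 1 ![-1, 1, -1] u) (cubeRot 1 ![-1, 1, -1] v) (cubeRot 1 ![-1, 1, -1] w) =
      cubeRot 1 ![-1, 1, -1] (T u v w))
    (hc : ∀ u v w, T (cubeRot (finRotate 3) (fun _ => 1) u) (cubeRot (finRotate 3) (fun _ => 1) v)
      (cubeRot (finRotate 3) (fun _ => 1) w) = cubeRot (finRotate 3) (fun _ => 1) (T u v w))
    (hq : ∀ u v w, T (cubeRot (Equiv.swap 0 1) ![-1, 1, 1] u) (cubeRot (Equiv.swap 0 1) ![-1, 1, 1] v)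
      (cubeRot (Equiv.swap 0 1) ![-1, 1, 1] w) = cubeRot (Equiv.swap 0 1) ![-1, 1, 1] (T u v w))
    (j k l i : Fin 3) :
    T (EuclideanSpace.single j (1 : ℝ)) (EuclideanSpace.single k (1 : ℝ)) (EuclideanSpace.single l (1 : ℝ)) i =
      T (EuclideanSpace.single 0 (1 : ℝ)) (EuclideanSpace.single 0 (1 : ℝ)) (EuclideanSpace.single 1 (1 : ℝ)) 1 *
          ((if j = k then 1 else 0) * (if i = l then 1 else 0) + (if k = l then 1 else 0) * (if i = j then 1 else 0) +
            (if l = j then 1 else 0) * (if i = k then 1 else 0)) +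
        (T (EuclideanSpace.single 0 (1 : ℝ)) (EuclideanSpace.single 0 (1 : ℝ)) (EuclideanSpace.single 0 (1 : ℝ)) 0 -
            3 * T (EuclideanSpace.single 0 (1 : ℝ)) (EuclideanSpace.single 0 (1 : ℝ)) (EuclideanSpace.single 1 (1 : ℝ)) 1) *
          ((if i = j then 1 else 0) * (if i = k then 1 else 0) * (if i = l then 1 else 0)) := by
  -- the two half-turn parities of this entry
  have p0 := parity_three h0 j k l i
  have p1 := parity_three h1 j k l i
  -- the diagonal entries agree (3-cycle): `A`
  have a1 : T (EuclideanSpace.single 0 (1 : ℝ)) (EuclideanSpace.single 0 (1 : ℝ)) (EuclideanSpace.single 0 (1 : ℝ)) 0 =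
      T (EuclideanSpace.single 1 (1 : ℝ)) (EuclideanSpace.single 1 (1 : ℝ)) (EuclideanSpace.single 1 (1 : ℝ)) 1 := by
    have h := congrArg (fun w : E3 => w 0)
      (hc (EuclideanSpace.single 1 1) (EuclideanSpace.single 1 1) (EuclideanSpace.single 1 1))
    simp only [cubeRot_cycle_single_one, cubeRot_cycle_apply_zero] at h
    exact h
  have a2 : T (EuclideanSpace.single 1 (1 : ℝ)) (EuclideanSpace.single 1 (1 : ℝ)) (EuclideanSpace.single 1 (1 : ℝ)) 1 =
      T (EuclideanSpace.single 2 (1 : ℝ)) (EuclideanSpace.single 2 (1 : ℝ)) (EuclideanSpace.single 2 (1 : ℝ)) 2 := by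
    have h := congrArg (fun w : E3 => w 1)
      (hc (EuclideanSpace.single 2 1) (EuclideanSpace.single 2 1) (EuclideanSpace.single 2 1))
    simp only [cubeRot_cycle_single_two, cubeRot_cycle_apply_one] at h
    exact h
  -- the entries of pattern `(iijj)` agree (3-cycle, quarter-turn): `B`
  have b1 : T (EuclideanSpace.single 0 (1 : ℝ)) (EuclideanSpace.single 0 (1 : ℝ)) (EuclideanSpace.single 1 (1 : ℝ)) 1 =
      T (EuclideanSpace.single 1 (1 : ℝ)) (EuclideanSpace.single 1 (1 : ℝ)) (EuclideanSpace.single 2 (1 : ℝ)) 2 := by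
    have h := congrArg (fun w : E3 => w 1)
      (hc (EuclideanSpace.single 1 1) (EuclideanSpace.single 1 1) (EuclideanSpace.single 2 1))
    simp only [cubeRot_cycle_single_one, cubeRot_cycle_single_two, cubeRot_cycle_apply_one] at h
    exact h
  have b2 : T (EuclideanSpace.single 1 (1 : ℝ)) (EuclideanSpace.single 1 (1 : ℝ)) (EuclideanSpace.single 2 (1 : ℝ)) 2 =
      T (EuclideanSpace.single 2 (1 : ℝ)) (EuclideanSpace.single 2 (1 : ℝ)) (EuclideanSpace.single 0 (1 : ℝ)) 0 := by
    have h := congrArg (fun w : E3 => w 2)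
      (hc (EuclideanSpace.single 2 1) (EuclideanSpace.single 2 1) (EuclideanSpace.single 0 1))
    simp only [cubeRot_cycle_single_two, cubeRot_cycle_single_zero, cubeRot_cycle_apply_two] at h
    exact h
  have b3 : T (EuclideanSpace.single 1 (1 : ℝ)) (EuclideanSpace.single 1 (1 : ℝ)) (EuclideanSpace.single 0 (1 : ℝ)) 0 =
      T (EuclideanSpace.single 2 (1 : ℝ)) (EuclideanSpace.single 2 (1 : ℝ)) (EuclideanSpace.single 1 (1 : ℝ)) 1 := by
    have h := congrArg (fun w : E3 => w 0)
      (hc (EuclideanSpace.single 2 1) (EuclideanSpace.single 2 1) (EuclideanSpace.single 1 1))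
    simp only [cubeRot_cycle_single_two, cubeRot_cycle_single_one, cubeRot_cycle_apply_zero] at h
    exact h
  have b4 : T (EuclideanSpace.single 2 (1 : ℝ)) (EuclideanSpace.single 2 (1 : ℝ)) (EuclideanSpace.single 1 (1 : ℝ)) 1 =
      T (EuclideanSpace.single 0 (1 : ℝ)) (EuclideanSpace.single 0 (1 : ℝ)) (EuclideanSpace.single 2 (1 : ℝ)) 2 := by
    have h := congrArg (fun w : E3 => w 1)
      (hc (EuclideanSpace.single 0 1) (EuclideanSpace.single 0 1) (EuclideanSpace.single 2 1))
    simp only [cubeRot_cycle_single_zero, cubeRot_cycle_single_two, cubeRot_cycle_apply_one] at h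
    exact h
  have bq : T (EuclideanSpace.single 0 (1 : ℝ)) (EuclideanSpace.single 0 (1 : ℝ)) (EuclideanSpace.single 2 (1 : ℝ)) 2 =
      T (EuclideanSpace.single 1 (1 : ℝ)) (EuclideanSpace.single 1 (1 : ℝ)) (EuclideanSpace.single 2 (1 : ℝ)) 2 := by
    have h := congrArg (fun w : E3 => w 2)
      (hq (EuclideanSpace.single 1 1) (EuclideanSpace.single 1 1) (EuclideanSpace.single 2 1))
    simp only [cubeRot_quarterTurn_single_one, cubeRot_quarterTurn_single_two, map_neg, neg_apply,
      neg_neg] at h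
    rw [cubeRot_quarterTurn_apply] at h
    simpa using h
  -- the three positions of the odd index agree (symmetry), for each of the six ordered pairs
  have s01 := congrArg (fun w : E3 => w 0) (hsym (EuclideanSpace.single 1 (1 : ℝ)) (EuclideanSpace.single 0 1) (EuclideanSpace.single 1 1))
  have s01' := congrArg (fun w : E3 => w 0) (hsym' (EuclideanSpace.single 1 (1 : ℝ)) (EuclideanSpace.single 1 1) (EuclideanSpace.single 0 1))
  have s02 := congrArg (fun w : E3 => w 0) (hsym (EuclideanSpace.single 2 (1 : ℝ)) (EuclideanSpace.single 0 1) (EuclideanSpace.single 2 1))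
  have s02' := congrArg (fun w : E3 => w 0) (hsym' (EuclideanSpace.single 2 (1 : ℝ)) (EuclideanSpace.single 2 1) (EuclideanSpace.single 0 1))
  have s10 := congrArg (fun w : E3 => w 1) (hsym (EuclideanSpace.single 0 (1 : ℝ)) (EuclideanSpace.single 1 1) (EuclideanSpace.single 0 1))
  have s10' := congrArg (fun w : E3 => w 1) (hsym' (EuclideanSpace.single 0 (1 : ℝ)) (EuclideanSpace.single 0 1) (EuclideanSpace.single 1 1))
  have s12 := congrArg (fun w : E3 => w 1) (hsym (EuclideanSpace.single 2 (1 : ℝ)) (EuclideanSpace.single 1 1) (EuclideanSpace.single 2 1))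
  have s12' := congrArg (fun w : E3 => w 1) (hsym' (EuclideanSpace.single 2 (1 : ℝ)) (EuclideanSpace.single 2 1) (EuclideanSpace.single 1 1))
  have s20 := congrArg (fun w : E3 => w 2) (hsym (EuclideanSpace.single 0 (1 : ℝ)) (EuclideanSpace.single 2 1) (EuclideanSpace.single 0 1))
  have s20' := congrArg (fun w : E3 => w 2) (hsym' (EuclideanSpace.single 0 (1 : ℝ)) (EuclideanSpace.single 0 1) (EuclideanSpace.single 2 1))
  have s21 := congrArg (fun w : E3 => w 2) (hsym (EuclideanSpace.single 1 (1 : ℝ)) (EuclideanSpace.single 2 1) (EuclideanSpace.single 1 1))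
  have s21' := congrArg (fun w : E3 => w 2) (hsym' (EuclideanSpace.single 1 (1 : ℝ)) (EuclideanSpace.single 1 1) (EuclideanSpace.single 2 1))
  simp only at s01 s01' s02 s02' s10 s10' s12 s12' s20 s20' s21 s21'
  have e2 : (⟨2, by omega⟩ : Fin 3) = 2 := rfl
  clear hsym hsym' h0 h1 hc hq
  fin_cases j <;> fin_cases k <;> fin_cases l <;> fin_cases i <;>
    simp only [Fin.zero_eta, Fin.mk_one, e2, Matrix.cons_val_zero, Matrix.cons_val_one, Matrix.cons_val_two, Matrix.tail_cons,
      Matrix.head_cons, mul_one, one_mul, neg_mul, mul_neg, neg_neg, Fin.reduceEq, if_true, if_false, mul_zero,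
      add_zero, zero_add] at p0 p1 ⊢ <;>
    first
    | linarith only [p0]
    | linarith only [p1]
    | linarith only [a1, a2, b1, b2, b3, b4, bq, s01, s01', s02, s02', s10, s10', s12, s12', s20, s20', s21, s21']

/-- ★ **The cubic O-equivariants, normal form.**  A SYMMETRIC trilinear map `T : ℝ³ × ℝ³ × ℝ³ → ℝ³` commuting with the half-turns about
`e₀`, `e₁`, the coordinate 3-cycle and the quarter-turn about `e₂` is
`T(u,v,w) = B·(⟪u,v⟫ w + ⟪v,w⟫ u + ⟪w,u⟫ v) + (A − 3B)·(uᵢvᵢwᵢ)ᵢ`, `A = T(e₀,e₀,e₀)₀`, `B = T(e₀,e₀,e₁)₁` — the polarisation of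
`x ↦ B‖x‖²x + ((A − 3B)/3)(xᵢ³)ᵢ`: the O-equivariant cubic maps are the plane `span{‖x‖²x, (xᵢ³)ᵢ} = span{∇‖x‖⁴, ∇Σxᵢ⁴}`. -/
theorem trilin_eq (hsym : ∀ u v w, T u v w = T v u w) (hsym' : ∀ u v w, T u v w = T u w v)
    (h0 : ∀ u v w, T (cubeRot 1 ![1, -1, -1] u) (cubeRot 1 ![1, -1, -1] v) (cubeRot 1 ![1, -1, -1] w) =
      cubeRot 1 ![1, -1, -1] (T u v w))
    (h1 : ∀ u v w, T (cubeRot 1 ![-1, 1, -1] u) (cubeRot 1 ![-1, 1, -1] v) (cubeRot 1 ![-1, 1, -1] w) =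
      cubeRot 1 ![-1, 1, -1] (T u v w))
    (hc : ∀ u v w, T (cubeRot (finRotate 3) (fun _ => 1) u) (cubeRot (finRotate 3) (fun _ => 1) v)
      (cubeRot (finRotate 3) (fun _ => 1) w) = cubeRot (finRotate 3) (fun _ => 1) (T u v w))
    (hq : ∀ u v w, T (cubeRot (Equiv.swap 0 1) ![-1, 1, 1] u) (cubeRot (Equiv.swap 0 1) ![-1, 1, 1] v)
      (cubeRot (Equiv.swap 0 1) ![-1, 1, 1] w) = cubeRot (Equiv.swap 0 1) ![-1, 1, 1] (T u v w))
    (u v w : E3) :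
    T u v w =
      T (EuclideanSpace.single 0 (1 : ℝ)) (EuclideanSpace.single 0 (1 : ℝ)) (EuclideanSpace.single 1 (1 : ℝ)) 1 •
          (⟪u, v⟫ • w + ⟪v, w⟫ • u + ⟪w, u⟫ • v) +
        (T (EuclideanSpace.single 0 (1 : ℝ)) (EuclideanSpace.single 0 (1 : ℝ)) (EuclideanSpace.single 0 (1 : ℝ)) 0 -
            3 * T (EuclideanSpace.single 0 (1 : ℝ)) (EuclideanSpace.single 0 (1 : ℝ)) (EuclideanSpace.single 1 (1 : ℝ)) 1) •
          WithLp.toLp 2 (fun i => u i * v i * w i) := by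
  have all := trilin_apply_single hsym hsym' h0 h1 hc hq
  set A := T (EuclideanSpace.single 0 (1 : ℝ)) (EuclideanSpace.single 0 (1 : ℝ)) (EuclideanSpace.single 0 (1 : ℝ)) 0 with hA
  set B := T (EuclideanSpace.single 0 (1 : ℝ)) (EuclideanSpace.single 0 (1 : ℝ)) (EuclideanSpace.single 1 (1 : ℝ)) 1 with hB
  have hu : u = ∑ j : Fin 3, u j • EuclideanSpace.single j (1 : ℝ) := by
    simpa using ((EuclideanSpace.basisFun (Fin 3) ℝ).sum_repr u).symm
  have hv : v = ∑ j : Fin 3, v j • EuclideanSpace.single j (1 : ℝ) := by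
    simpa using ((EuclideanSpace.basisFun (Fin 3) ℝ).sum_repr v).symm
  have hw : w = ∑ j : Fin 3, w j • EuclideanSpace.single j (1 : ℝ) := by
    simpa using ((EuclideanSpace.basisFun (Fin 3) ℝ).sum_repr w).symm
  ext i
  conv_lhs => rw [hu, hv, hw]
  simp only [Fin.sum_univ_three, map_add, map_smul, add_apply, FunLike.coe_smul,
    Pi.smul_apply, PiLp.add_apply, PiLp.smul_apply, smul_eq_mul, all]
  fin_cases i <;> simp [PiLp.inner_apply, Fin.sum_univ_three] <;> ring

/-- The TRACE of a symmetric trilinear O-equivariant: `Σᵢ T(u, v, eᵢ)ᵢ = (A + 2B) ⟪u, v⟫` (so the cubic map `x ↦ T(x,x,x)/6` has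
divergence `(A + 2B)‖x‖²/2`; it is divergence-free iff `A + 2B = 0`). -/
theorem trilin_trace (hsym : ∀ u v w, T u v w = T v u w) (hsym' : ∀ u v w, T u v w = T u w v)
    (h0 : ∀ u v w, T (cubeRot 1 ![1, -1, -1] u) (cubeRot 1 ![1, -1, -1] v) (cubeRot 1 ![1, -1, -1] w) =
      cubeRot 1 ![1, -1, -1] (T u v w))
    (h1 : ∀ u v w, T (cubeRot 1 ![-1, 1, -1] u) (cubeRot 1 ![-1, 1, -1] v) (cubeRot 1 ![-1, 1, -1] w) =
      cubeRot 1 ![-1, 1, -1] (T u v w))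
    (hc : ∀ u v w, T (cubeRot (finRotate 3) (fun _ => 1) u) (cubeRot (finRotate 3) (fun _ => 1) v)
      (cubeRot (finRotate 3) (fun _ => 1) w) = cubeRot (finRotate 3) (fun _ => 1) (T u v w))
    (hq : ∀ u v w, T (cubeRot (Equiv.swap 0 1) ![-1, 1, 1] u) (cubeRot (Equiv.swap 0 1) ![-1, 1, 1] v)
      (cubeRot (Equiv.swap 0 1) ![-1, 1, 1] w) = cubeRot (Equiv.swap 0 1) ![-1, 1, 1] (T u v w))
    (u v : E3) :
    ∑ i : Fin 3, T u v (EuclideanSpace.single i (1 : ℝ)) i =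
      (T (EuclideanSpace.single 0 (1 : ℝ)) (EuclideanSpace.single 0 (1 : ℝ)) (EuclideanSpace.single 0 (1 : ℝ)) 0 +
          2 * T (EuclideanSpace.single 0 (1 : ℝ)) (EuclideanSpace.single 0 (1 : ℝ)) (EuclideanSpace.single 1 (1 : ℝ)) 1) *
        ⟪u, v⟫ := by
  set A := T (EuclideanSpace.single 0 (1 : ℝ)) (EuclideanSpace.single 0 (1 : ℝ)) (EuclideanSpace.single 0 (1 : ℝ)) 0 with hA
  set B := T (EuclideanSpace.single 0 (1 : ℝ)) (EuclideanSpace.single 0 (1 : ℝ)) (EuclideanSpace.single 1 (1 : ℝ)) 1 with hB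
  have key : ∀ i : Fin 3, T u v (EuclideanSpace.single i (1 : ℝ)) i =
      B * (⟪u, v⟫ * 1 + v i * u i + u i * v i) + (A - 3 * B) * (u i * v i * 1) := by
    intro i
    have h := congrArg (fun z : E3 => z i) (trilin_eq hsym hsym' h0 h1 hc hq u v (EuclideanSpace.single i (1 : ℝ)))
    simp only [PiLp.add_apply, PiLp.smul_apply, smul_eq_mul, EuclideanSpace.inner_single_left,
      EuclideanSpace.inner_single_right, map_one, one_mul] at h
    rw [← hB, ← hA] at h
    simp only [EuclideanSpace.single, PiLp.single_apply, if_true] at h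
    linear_combination h
  simp only [Fin.sum_univ_three, key]
  simp only [PiLp.inner_apply, RCLike.inner_apply, conj_trivial, Fin.sum_univ_three]
  ring

/-- The TANGENCY FORM of a symmetric trilinear O-equivariant: `⟪u, T(u,u,u)⟫ = (A − 3B) Σᵢ uᵢ⁴ + 3B ‖u‖⁴` (with `‖u‖⁴ = ⟪u,u⟫²`). -/
theorem trilin_inner_self (hsym : ∀ u v w, T u v w = T v u w) (hsym' : ∀ u v w, T u v w = T u w v)
    (h0 : ∀ u v w, T (cubeRot 1 ![1, -1, -1] u) (cubeRot 1 ![1, -1, -1] v) (cubeRot 1 ![1, -1, -1] w) =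
      cubeRot 1 ![1, -1, -1] (T u v w))
    (h1 : ∀ u v w, T (cubeRot 1 ![-1, 1, -1] u) (cubeRot 1 ![-1, 1, -1] v) (cubeRot 1 ![-1, 1, -1] w) =
      cubeRot 1 ![-1, 1, -1] (T u v w))
    (hc : ∀ u v w, T (cubeRot (finRotate 3) (fun _ => 1) u) (cubeRot (finRotate 3) (fun _ => 1) v)
      (cubeRot (finRotate 3) (fun _ => 1) w) = cubeRot (finRotate 3) (fun _ => 1) (T u v w))
    (hq : ∀ u v w, T (cubeRot (Equiv.swap 0 1) ![-1, 1, 1] u) (cubeRot (Equiv.swap 0 1) ![-1, 1, 1] v)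
      (cubeRot (Equiv.swap 0 1) ![-1, 1, 1] w) = cubeRot (Equiv.swap 0 1) ![-1, 1, 1] (T u v w))
    (u : E3) :
    ⟪u, T u u u⟫ =
      (T (EuclideanSpace.single 0 (1 : ℝ)) (EuclideanSpace.single 0 (1 : ℝ)) (EuclideanSpace.single 0 (1 : ℝ)) 0 -
            3 * T (EuclideanSpace.single 0 (1 : ℝ)) (EuclideanSpace.single 0 (1 : ℝ)) (EuclideanSpace.single 1 (1 : ℝ)) 1) *
          ∑ i : Fin 3, u i ^ 4 +
        3 * T (EuclideanSpace.single 0 (1 : ℝ)) (EuclideanSpace.single 0 (1 : ℝ)) (EuclideanSpace.single 1 (1 : ℝ)) 1 * ⟪u, u⟫ ^ 2 := by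
  set A := T (EuclideanSpace.single 0 (1 : ℝ)) (EuclideanSpace.single 0 (1 : ℝ)) (EuclideanSpace.single 0 (1 : ℝ)) 0 with hA
  set B := T (EuclideanSpace.single 0 (1 : ℝ)) (EuclideanSpace.single 0 (1 : ℝ)) (EuclideanSpace.single 1 (1 : ℝ)) 1 with hB
  rw [trilin_eq hsym hsym' h0 h1 hc hq u u u, ← hB, ← hA]
  have h4 : ⟪u, WithLp.toLp 2 (fun i => u i * u i * u i)⟫ = ∑ i : Fin 3, u i ^ 4 := by
    rw [PiLp.inner_apply]
    exact Finset.sum_congr rfl fun i _ => by simp only [RCLike.inner_apply, conj_trivial]; ring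
  simp only [inner_add_right, inner_smul_right, h4]
  ring

/-- ★ **A symmetric trilinear O-equivariant whose tangency form vanishes is zero**: if `⟪u, T(u,u,u)⟫ = 0` for every `u` then `T = 0`
(`u = e₀` gives `A = 0`, `u = e₀ + e₁` gives `2A + 6B = 0`).  This is the algebra behind (J4′): unthreadedness kills the cubic vorticity
jet of the O-class. -/
theorem trilin_eq_zero_of_inner_self (hsym : ∀ u v w, T u v w = T v u w) (hsym' : ∀ u v w, T u v w = T u w v)
    (h0 : ∀ u v w, T (cubeRot 1 ![1, -1, -1] u) (cubeRot 1 ![1, -1, -1] v) (cubeRot 1 ![1, -1, -1] w) =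
      cubeRot 1 ![1, -1, -1] (T u v w))
    (h1 : ∀ u v w, T (cubeRot 1 ![-1, 1, -1] u) (cubeRot 1 ![-1, 1, -1] v) (cubeRot 1 ![-1, 1, -1] w) =
      cubeRot 1 ![-1, 1, -1] (T u v w))
    (hc : ∀ u v w, T (cubeRot (finRotate 3) (fun _ => 1) u) (cubeRot (finRotate 3) (fun _ => 1) v)
      (cubeRot (finRotate 3) (fun _ => 1) w) = cubeRot (finRotate 3) (fun _ => 1) (T u v w))
    (hq : ∀ u v w, T (cubeRot (Equiv.swap 0 1) ![-1, 1, 1] u) (cubeRot (Equiv.swap 0 1) ![-1, 1, 1] v)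
      (cubeRot (Equiv.swap 0 1) ![-1, 1, 1] w) = cubeRot (Equiv.swap 0 1) ![-1, 1, 1] (T u v w))
    (htan : ∀ u, ⟪u, T u u u⟫ = 0) :
    T = 0 := by
  set A := T (EuclideanSpace.single 0 (1 : ℝ)) (EuclideanSpace.single 0 (1 : ℝ)) (EuclideanSpace.single 0 (1 : ℝ)) 0 with hA
  set B := T (EuclideanSpace.single 0 (1 : ℝ)) (EuclideanSpace.single 0 (1 : ℝ)) (EuclideanSpace.single 1 (1 : ℝ)) 1 with hB
  have form := trilin_inner_self hsym hsym' h0 h1 hc hq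
  -- `u = e₀`: `A = 0`
  have hA0 : A = 0 := by
    have h := form (EuclideanSpace.single 0 (1 : ℝ))
    rw [htan, ← hB, ← hA] at h
    simp at h
    linarith
  -- `u = e₀ + e₁`: `2A + 6B = 0`
  have hB0 : B = 0 := by
    have h := form (EuclideanSpace.single 0 (1 : ℝ) + EuclideanSpace.single 1 (1 : ℝ))
    rw [htan, ← hB, ← hA] at h
    have n2 : ⟪EuclideanSpace.single (0 : Fin 3) (1 : ℝ) + EuclideanSpace.single 1 (1 : ℝ),
        EuclideanSpace.single (0 : Fin 3) (1 : ℝ) + EuclideanSpace.single 1 (1 : ℝ)⟫ = 2 := by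
      rw [inner_add_left, inner_add_right, inner_add_right]
      simp only [EuclideanSpace.inner_single_left, map_one, one_mul]
      simp
      norm_num
    rw [n2] at h
    simp [Fin.sum_univ_three] at h
    linarith
  ext u v w i
  rw [trilin_eq hsym hsym' h0 h1 hc hq u v w, ← hB, ← hA, hA0, hB0]
  simp

end Trilinear

end CentreFlat

end Summit.NavierStokesRegularity.NavierStokesRegularity.Theorems.PoloidalLiouville.Platonic

end
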